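import Literature.AnabelianGeometry.EtaleTheta.TemperedFrobenioidToyGenuine
import Literature.AnabelianGeometry.EtaleTheta.RealifiedDivisorMonoidsOfRlfR
import Literature.AnabelianGeometry.EtaleTheta.Discharge.Sec3Remark363OfRlf
import Literature.AnabelianGeometry.EtaleTheta.Discharge.Sec3Thm37Units
import HarnessLib

/-!
# [EtTh] Def. 3.6 (ii) at monoid type `Λ = ℝ`: a tempered Frobenioid over the CONSTRUCTED data `ofRlfR` and
# the tree's GENUINE [FrdI] vocabularies (non-vacuity witness), with Rmk. 3.6.3 and Thm. 3.7 (iv) OUTRIGHT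

S. Mochizuki, *The étale theta function and its Frobenioid-theoretic manifestations*, Publ. RIMS **45**
(2009) [MochizukiEtTh2009], Def. 3.6 (i)–(ii) PDF pp. 76–77 (printed 302–303): "`B₀^Λ ⊆ (Φ₀^ℝ)^gp` for the
monoid … `ℝ·Φ₀^birat ⊆ (Φ₀^ℝ)^gp`; `F₀^Λ ⊆ B₀^Λ` for the submonoid … `ℝ·Φ₀^cnst` if … `Λ = ℝ`"; Rmk. 3.6.3
p. 79; Thm. 3.7 (i)/(iv) pp. 79–80; S. Mochizuki, *The geometry of Frobenioids I* [MochizukiFrdI2008],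
Thm. 5.2 (ii) p. 100 (model Frobenioids are Frobenioids).

abc-iut cell, block F, seat abc-iut-f-136 (FACT-LIST row F-0581 `TemperedFrobenioid.Remark363`; cf. F-0744
`Thm37_iv`, F-0743 `Thm37_i`).  MODEL-CONSTRUCTION file («post-freeze class (b)»: new path, nothing frozen edited;
one `def`, the rest theorems), the monoid-type-`ℝ` twin of abc-iut-w5-d164's `TemperedFrobenioidToyGenuine.lean`
(p-id of record there).  The tree states several theorems for EVERY tempered Frobenioid over abc-iut-w4-d084's
constructor `RealifiedDivisorMonoids.ofRlfR dm hpf` — abc-iut-f-136's `TemperedFrobenioid.remark363_ofRlfR`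
(Rmk. 3.6.3, binder-free), abc-iut-w5-d250/w4-d103-lineage `thm37_iv_ofRlfR`, `thm37_i_unitTrivial_ofRlfR`
(`Discharge/Sec3Thm37Units.lean`, modulo `hF`), abc-iut-w4-d008's `exists_cnstFn_effective_ofRlfR` — while NO
inhabitant of `TemperedFrobenioid (ofRlfR _ _) _ _` existed in the tree.  THIS FILE builds one:

* `Toy.genuineTemperedFrobenioidR R S : TemperedFrobenioid (ofRlfR Toy.divisorMonoids _) (Discrete PUnit)
  (treeCatVocab (Discrete PUnit) R S)` — the SAME Def. 3.6 (ii) data as `Toy.genuineTemperedFrobenioid R S`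
  (`D = D₀ =` one object, `Φ := im(Φ₀^pf → Φ₀^rlf) ≅ ℚ_{≥0}` inside `Φ^{ℝ-log} = ℕ^rlf`, group-saturated,
  perf-factorial, divisorial, `Φ^{bs-fld} = Φ` monoprime — `ofRlfR` and `ofRlfZ` SHARE `Φ₀^ℝ` and `ℝ·Φ₀^cnst`),
  now over the monoid-type-`ℝ` data `B₀^ℝ = ℝ·Φ₀^birat`, `F₀^ℝ = B₀^ℝ ∩ ℝ·Φ₀^cnst`; the one field with new
  content is Def. 3.6 (ii)(b): the constant `ι(div₀ 𝔭) ∈ F₀^ℝ` has the nonzero divisor `ι(𝔭)/1`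
  (`gpMap_toR_div₀_mem_realSpan_biratGp`, `gpMap_toR_div₀_mem_cnstR`);
* `Toy.isFrobenioid_genuineTemperedFrobenioidR` — its model category IS a Frobenioid ([FrdI] Thm. 5.2 (ii),
  abc-iut-found's `ModelFrobenioid.isFrobenioid`), exactly as for the `Λ = ℤ` twin;
* consequences OUTRIGHT at this inhabitant, by name: **`Toy.remark363_genuineTemperedFrobenioidR`** (Rmk. 3.6.3 =
  F-0581, from `remark363_ofRlfR` — no binder at all), **`Toy.thm37_iv_genuineTemperedFrobenioidR`** (Thm. 3.7
  (iv) = F-0744 `Thm37_iv`, from `thm37_iv_ofRlfR` + `hF`), `Toy.thm37_i_unitTrivial_genuineTemperedFrobenioidR`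
  (Thm. 3.7 (i) "unit-trivial type" at `Λ = ℝ`), and `Toy.nonempty_temperedFrobenioid_ofRlfR`.

HONEST LABEL: GENUINE vocabularies / realification / `ℝ`-spans / [FrdI] predicates / Frobenioid certificate;
DEGENERATE geometry — one object, one prime, all functions constant.  A consistency and instantiation witness
for the `ofRlfR`-indexed theorems of the tree; NOT the tempered Frobenioid of a curve; nothing here bears on
[IUTchIII] Cor. 3.12; no side taken.  Typed ≠ proved.
-/

noncomputable section

namespace Literature.AnabelianGeometry.EtaleTheta

open CategoryTheory Opposite Literature.AlgebraicGeometry.Frobenioids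

namespace Toy

open Example39NV

/-! ### The monoid-type-`ℝ` realified data at the toy -/

/-- The Def. 3.6 (i) realified data of monoid type `ℝ` CONSTRUCTED from the toy Def. 3.3 (iii) data:
abc-iut-w4-d084's `ofRlfR` at `Toy.divisorMonoids` (`Φ₀ = ℕ`, `Φ₀^ℝ = ℕ^rlf`, `B₀^ℝ = ℝ·Φ₀^birat`,
`F₀^ℝ = B₀^ℝ ∩ ℝ·Φ₀^cnst`). [cite: MochizukiEtTh2009, Def 3.6 p.76] -/
abbrev realifiedGenuineR : RealifiedDivisorMonoids (D₀ := Discrete PUnit.{1}) treeMonoidVocab.{0} :=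
  RealifiedDivisorMonoids.ofRlfR divisorMonoids isPerfFactorial_Φ₀

/-- `ofRlfR` and `ofRlfZ` share `Φ₀^ℝ = Φ₀^rlf` at the toy. [cite: MochizukiEtTh2009, Def 3.6 p.76] -/
theorem realifiedGenuineR_ΦR : realifiedGenuineR.ΦR = realifiedGenuine.ΦR := rfl

/-- `ofRlfR` and `ofRlfZ` share `ℝ·Φ₀^cnst` at the toy. [cite: MochizukiEtTh2009, Def 3.6 p.76] -/
theorem realifiedGenuineR_cnstR (Y : (Discrete PUnit.{1})ᵒᵖ) : realifiedGenuineR.cnstR Y = realifiedGenuine.cnstR Y :=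
  rfl

/-- The image in `(Φ₀^ℝ)^gp(Y)` of the divisor `div₀(b)` of a function `b ∈ B₀(Y) = ℤ` lies in
`B₀^ℝ(Y) = ℝ·Φ₀^birat(Y)`. [cite: MochizukiEtTh2009, Def 3.6 p.76] -/
theorem gpMap_toR_div₀_mem_realSpan_biratGp (Y : (Discrete PUnit.{1})ᵒᵖ) (b : Multiplicative ℤ) :
    EtaleTheta.gpMap (realifiedGenuineR.toR Y) (divisorMonoids.div₀ Y b) ∈
      ((RealifiedDivisorMonoids.realData divisorMonoids isPerfFactorial_Φ₀).realSpan
        divisorMonoids.biratGp).carrier (unop Y) := by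
  have h := (RealifiedDivisorMonoids.realData divisorMonoids isPerfFactorial_Φ₀).toRlfGp_mem_realSpan
    divisorMonoids.biratGp (unop Y) (c := divisorMonoids.div₀ Y b) (Subgroup.subset_closure ⟨b, rfl⟩)
  rw [RealifiedDivisorMonoids.toRlfGp_realData_eq] at h
  exact h

/-- … and in `ℝ·Φ₀^cnst(Y)` (every function of the toy is constant: `F₀ = B₀`).
[cite: MochizukiEtTh2009, Def 3.6 p.76] -/
theorem gpMap_toR_div₀_mem_cnstR (Y : (Discrete PUnit.{1})ᵒᵖ) (b : Multiplicative ℤ) :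
    EtaleTheta.gpMap (realifiedGenuineR.toR Y) (divisorMonoids.div₀ Y b) ∈ realifiedGenuineR.cnstR Y :=
  realifiedGenuineR.cnst_le_cnstR Y b (Submonoid.mem_top _)

/-- The constant function `ι(div₀ b) ∈ B₀^ℝ(Y)` of the toy at monoid type `ℝ`.
[cite: MochizukiEtTh2009, Def 3.6 p.76] -/
def cnstFnR (Y : (Discrete PUnit.{1})ᵒᵖ) (b : Multiplicative ℤ) : realifiedGenuineR.BΛ.obj Y :=
  ⟨EtaleTheta.gpMap (realifiedGenuineR.toR Y) (divisorMonoids.div₀ Y b), gpMap_toR_div₀_mem_realSpan_biratGp Y b⟩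

/-- `ι(div₀ b)` lies in `F₀^ℝ(Y) = B₀^ℝ(Y) ∩ ℝ·Φ₀^cnst(Y)`. [cite: MochizukiEtTh2009, Def 3.6 p.76] -/
theorem cnstFnR_mem_FΛ (Y : (Discrete PUnit.{1})ᵒᵖ) (b : Multiplicative ℤ) :
    cnstFnR Y b ∈ realifiedGenuineR.FΛ Y :=
  gpMap_toR_div₀_mem_cnstR Y b

/-- Its log-divisor `Div(ι(div₀ b)) ∈ (Φ₀^ℝ)^gp(Y)` is `ι(div₀ b)` itself (`B₀^ℝ → (Φ₀^ℝ)^gp` is the inclusion).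
[cite: MochizukiEtTh2009, Def 3.6 p.76] -/
theorem divΛ_cnstFnR (Y : (Discrete PUnit.{1})ᵒᵖ) (b : Multiplicative ℤ) :
    realifiedGenuineR.divΛ Y (cnstFnR Y b) =
      EtaleTheta.gpMap (realifiedGenuineR.toR Y) (divisorMonoids.div₀ Y b) :=
  rfl

variable (R S : ((Discrete PUnit.{1})ᵒᵖ ⥤ CommMonCat.{0}) → Prop)

/-! ### The tempered Frobenioid of monoid type `ℝ` over the genuine vocabularies -/

/-- **Def. 3.6 (ii) data of monoid type `ℝ` over the GENUINE vocabularies** — the tempered Frobenioid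
structure on `(D := Discrete PUnit → D₀, Φ := im(Φ₀^pf → Φ₀^rlf))` over `ofRlfR Toy.divisorMonoids`: the fields
not involving `B₀^Λ`/`F₀^Λ` are those of the `Λ = ℤ` twin `Toy.genuineTemperedFrobenioid` verbatim (`ofRlfR`
and `ofRlfZ` share `Φ₀^ℝ` and `ℝ·Φ₀^cnst`); (b) the constant `ι(div₀ 𝔭) ∈ F₀^ℝ` has divisor `ι(𝔭)/1`,
`ι(𝔭) ≠ 1`. [cite: MochizukiEtTh2009, Def 3.6 p.77] -/
def genuineTemperedFrobenioidR :
    TemperedFrobenioid realifiedGenuineR (Discrete PUnit.{1}) (treeCatVocab (Discrete PUnit.{1}) R S) where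
  isConnected := temperedFrobenioid.isConnected
  isTotallyEpimorphic := temperedFrobenioid.isTotallyEpimorphic
  base := 𝟭 _
  Φ := genuineΦ
  isGroupSaturated A := isGroupSaturated_mrange_toRealification (isPerfFactorial_Φ₀ A)
  isPerfFactorial A := isPerfFactorial_mrange_toRealification (isMonoprime_Φ₀ A)
  isDivisorialOn := by
    rw [treeCatVocab_isDivisorialOn]
    exact ⟨Cor38Toy.isMonoidOn_of_punit _, fun A => MonoprimeStructure.isDivisorial (isMonoprime_pfImage (op A))⟩
  isMonoprime_bsFld A :=
    IsMonoprime.of_mulEquiv (MulEquiv.submonoidCongr (pfImage_inf_cnstR_eq A).symm) (isMonoprime_pfImage A)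
  exists_FΛ_div_ne A := by
    refine ⟨cnstFnR A (Multiplicative.ofAdd (1 : ℤ)), cnstFnR_mem_FΛ A _,
      (isPerfFactorial_Φ₀ A).toRealification (Perfection.of _ (Multiplicative.ofAdd (1 : ℕ))),
      ⟨_, rfl⟩, 1, one_mem _, toRealification_of_ofAdd_one_ne_one A, ?_⟩
    show EtaleTheta.gpMap (realifiedGenuineR.toR A) (divHom (Multiplicative.ofAdd (1 : ℤ))) = _
    simp only [map_one, div_one]
    exact (congrArg (EtaleTheta.gpMap (realifiedGenuineR.toR A)) divHom_ofAdd_one).trans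
      (EtaleTheta.gpMap_of _ _)

/-- `Φ` of the genuine `Λ = ℝ` toy is `pfImage`. [cite: MochizukiEtTh2009, Def 3.6 p.77] -/
@[simp] theorem genuineTemperedFrobenioidR_Φ_carrier (A : (Discrete PUnit.{1})ᵒᵖ) :
    (genuineTemperedFrobenioidR R S).Φ.carrier A = pfImage A := rfl

/-- The base functor of the genuine `Λ = ℝ` toy is the identity. [cite: MochizukiEtTh2009, Def 3.6 p.77] -/
@[simp] theorem genuineTemperedFrobenioidR_base : (genuineTemperedFrobenioidR R S).base = 𝟭 _ := rfl

/-- Its monoid type is `ℝ`. [cite: MochizukiEtTh2009, Def 3.6 p.77] -/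
theorem genuineTemperedFrobenioidR_monoidType : (genuineTemperedFrobenioidR R S).monoidType = MonoidType.R := rfl

/-- **`TemperedFrobenioid (ofRlfR _ _) _ _` is inhabited** (the data binder of the tree's `…_ofRlfR` theorems).
[cite: MochizukiEtTh2009, Def 3.6 p.77] -/
theorem nonempty_temperedFrobenioid_ofRlfR :
    Nonempty (TemperedFrobenioid (RealifiedDivisorMonoids.ofRlfR divisorMonoids isPerfFactorial_Φ₀)
      (Discrete PUnit.{1}) (treeCatVocab (Discrete PUnit.{1}) R S)) :=
  ⟨genuineTemperedFrobenioidR R S⟩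

/-! ### The resulting model Frobenioid IS a Frobenioid ([FrdI] Thm. 5.2 (ii)) -/

/-- **The genuine `Λ = ℝ` toy tempered Frobenioid is a Frobenioid** (`hF`), by [FrdI] Thm. 5.2 (ii)
(abc-iut-found's `ModelFrobenioid.isFrobenioid`): `Φ`, `B` monoids on the one-object base, `Φ` divisorial,
`B = B₀^ℝ|_D ×_{(Φ^{ℝ-log})^gp} Φ^gp` group-like (`isGroupLike_ratFnFunctor` from `B₀^ℝ` group-like), `D`
connected and totally epimorphic. [cite: MochizukiFrdI2008, Thm. 5.2(ii) p.100] -/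
theorem isFrobenioid_genuineTemperedFrobenioidR :
    PreFrobenioid.IsFrobenioid (genuineTemperedFrobenioidR R S).toElem :=
  ModelFrobenioid.isFrobenioid
    (Cor38Toy.isMonoidOn_of_punit _)
    (fun A => MonoprimeStructure.isDivisorial (isMonoprime_pfImage (op A)))
    (Cor38Toy.isMonoidOn_of_punit _)
    ((genuineTemperedFrobenioidR R S).isGroupLike_ratFnFunctor realifiedGenuineR.isUnit_BΛ)
    (isGraphConnected_iff_isConnected.mpr (genuineTemperedFrobenioidR R S).isConnected)
    (genuineTemperedFrobenioidR R S).isTotallyEpimorphic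

/-! ### Rmk. 3.6.3 and Thm. 3.7 (i)/(iv) OUTRIGHT at the inhabitant -/

/-- **[EtTh] Rmk. 3.6.3 (F-0581 `Remark363`) holds OUTRIGHT for the genuine `Λ = ℝ` toy**: `C^{bs-fld} → C` is
isomorphism-full with the printed description of the morphisms of its essential image — abc-iut-f-136's
binder-free `TemperedFrobenioid.remark363_ofRlfR`, instantiated. [cite: MochizukiEtTh2009, Rmk 3.6.3 p.79] -/
theorem remark363_genuineTemperedFrobenioidR : (genuineTemperedFrobenioidR R S).Remark363 :=
  (genuineTemperedFrobenioidR R S).remark363_ofRlfR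

/-- **[EtTh] Thm. 3.7 (iv) (F-0744 `Thm37_iv`) holds OUTRIGHT for the genuine `Λ = ℝ` toy** ("if `D` is slim and
`Λ ∈ {ℤ, ℝ}` then `C` is slim"), by `thm37_iv_ofRlfR` with `hF` supplied by
`isFrobenioid_genuineTemperedFrobenioidR`. [cite: MochizukiEtTh2009, Thm 3.7 p.80] -/
theorem thm37_iv_genuineTemperedFrobenioidR : (genuineTemperedFrobenioidR R S).Thm37_iv :=
  (genuineTemperedFrobenioidR R S).thm37_iv_ofRlfR divisorMonoids isPerfFactorial_Φ₀
    (isFrobenioid_genuineTemperedFrobenioidR R S)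

/-- **[EtTh] Thm. 3.7 (i), "`Λ = ℝ` ⇒ unit-trivial type", OUTRIGHT for the genuine `Λ = ℝ` toy**, by
`thm37_i_unitTrivial_ofRlfR` with `hF`. [cite: MochizukiEtTh2009, Thm 3.7 p.79] -/
theorem thm37_i_unitTrivial_genuineTemperedFrobenioidR :
    PreFrobenioid.IsOfType (PreFrobenioid.IsUnitTrivial (genuineTemperedFrobenioidR R S).toElem) :=
  (genuineTemperedFrobenioidR R S).thm37_i_unitTrivial_ofRlfR divisorMonoids isPerfFactorial_Φ₀
    (isFrobenioid_genuineTemperedFrobenioidR R S)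

end Toy

end Literature.AnabelianGeometry.EtaleTheta

end
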